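import Summits.MatrixMultiplication.MatrixMultiplication.Theorems.AbelianSTPPCensusU11KP

/-!
# Rule U11-KP♯: the Kneser–Pollard floor with the SUBGROUP-aware loss, CONDITIONAL on Grynkiewicz–Wang's Conjecture 2.2

Cell mm-stpp (rung F-M1), theory lane gen 15, «past the QUARTET's walls» (census-silent; refines `AbelianSTPPCensusU11KP`).  Rule U11-KP
(`U11KPFormB`) charges, at parameter `t`, the loss `u(t − 2u)` for every small period `u` that the fibre lemma cannot exclude.  Conjecture 2.2
says more about the structured branch: the period is a SUBGROUP `H = 𝖧(X +_t Y)` (the stabilizer of the `t`-popular set) with `t = s|H| + u`,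
so (when `s ≥ 1`, the only case the fibre lemma leaves) `h := |H|` divides `|G| = M` AND `t − u`, `u ≤ h ≤ t − u`, and the loss is `u(h − u)`.
Moreover the `t`-popular set `S_t = X +_t Y` is `H`-periodic and misses `Z′_{<t} := ⋃_{b_i < t} (C_i − A_i)` (those elements have
`r_{X,Y} = b_i < t`, `STPPRepCount.repCount_eq`), hence misses the whole hull `Z′_{<t} + H`; every element of the hull outside `Z′_{<t}` has
fewer than `t` representations while the ceiling `UB_B(t)` (`STPPRepCount.Nt_le_ubB`) charges it `t` — so the ceiling drops by
`|Z′_{<t} + H| − |Z′_{<t}| ≥ h⌈P/h⌉ − P` with `P = |Z′_{<t}| = Σ_{b_i<t} c_i a_i` (`Nt_add_card_le_ubB`, `Finset.card_addStab_dvd_card_add_addStab`).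

* `KneserPollard.KneserPollardDichotomySharp A B t` — the consumer dichotomy keeping `h = |𝖧(A +_t B)|` (`Finset.addStab` of the tree's Kneser file):
  Pollard floor, or `A′, B′, u` with fewer than `u` exceptions and `A′ + B′` `u`-popular, and either `u = t` or
  [`u ≤ h`, `h ∣ t − u`, `u + h ≤ t`, floor up to `u(h − u)`]; `…Sharp_of_conclusion` (from the printed conclusion, predicate
  `KneserPollard.KneserPollardConclusion` of `AbelianSTPPCensusU11KP`), `dichotomy_of_sharp` (it implies the plain dichotomy);
* `hullSlack P h = (h − P mod h) mod h` (`= h⌈P/h⌉ − P` for `h ≥ 1`), `pCAlt a b c t = Σ_{b_i < t} c_i a_i`,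
  `lossKPSharp M a b c t = max {u(h − u) − hullSlack(pCAlt t, h) : 1 ≤ u ≤ h, h ∣ M, h ∣ t − u, u + h ≤ t, L_B(u) < u}` (`0` if empty; over
  `Nat.divisors M`, computable);
* `U11KPSharpFormB M a b c` — **rule U11-KP♯, form B**: for every `t` with `1 ≤ t ≤ min(P_AB, P_BC)` and `t ≤ L_B(t)`:
  `t (P_AB + P_BC) ≤ UB_B(t) + t² + lossKPSharp M a b c t`; `U11KPSharp` — three letter forms (♯ ⇒ U11-KP clause-wise: companion file
  `AbelianSTPPCensusU11KPSharpEval`, with `kneserPollardSharp_of_printed` and the separating example);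
* `u11KPSharpFormB_of_kneserPollardSharp`, `u11KPSharp_of_…`, `u11KPSharpSound_of_…`, — CONDITIONAL soundness,
  exactly as in `AbelianSTPPCensusU11KP` with the sharp dichotomy as the explicit hypothesis (implied by the printed Conjecture 2.2).

Effect (exact twin `calc/u11c.py`, `loss_sharp`): at `M = 648 = 2³·3⁴` the uniform list `(7,7,7)⁵` passes U11-KP (loss `7(t − 14)` at every `t`)
but fails U11-KP♯ (e.g. `t = 44`: the divisors `h` of `648` dividing some `t − u`, `u ≤ 7`, are `≤ 8`, loss `≤ 13`; kernel in the companion file); in the champion family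
«near-uniform cubes + one member» the conditional T_E frontier moves from `648` (U11-KP) to beyond `800` (U11-KP♯), i.e. to Pollard strength.
WHAT THIS IS NOT: not a theorem that STPP families satisfy U11-KP♯ (CONDITIONAL on an open conjecture, stated as an explicit hypothesis; no
Literature fact, no `@[conjecture]` item filed); no census number; no `ω` statement.

## References
* D. J. Grynkiewicz, R. Wang, *Pollard's theorem in general abelian groups*, arXiv:2601.17922 (2026), §2.1 Conjecture 2.2 (open).
* M. Kneser, Math. Z. 58 (1953) (stabilizers; tree `Literature.Combinatorics.Additive.Kneser`, `Finset.addStab` API).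
-/

set_option linter.dupNamespace false -- `MatrixMultiplication.MatrixMultiplication` (summit = problem, D-0017)
set_option autoImplicit false

namespace Summit.MatrixMultiplication.MatrixMultiplication.Theorems

open Finset Literature.Computability.AlgebraicComplexity Literature.Combinatorics.Additive
open scoped Pointwise

/-! ### The sharp consumer dichotomy (predicate; nothing asserted) -/

namespace KneserPollard

variable {G : Type*} [AddCommGroup G] [DecidableEq G]

/-- **The sharp Kneser–Pollard dichotomy for the data `(A, B, t)`**: either the Pollard floor `t|A| + t|B| ≤ Σ_{x∈A+B} min(t, r_{A,B}(x)) + t²`,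
or there are `u` and `A′ ⊆ A`, `B′ ⊆ B` with `1 ≤ u ≤ t`, fewer than `u` exceptions, every element of `A′ + B′` `u`-popular in `A + B`, and
either `u = t`, or — with `h = |𝖧(A +_t B)|` the cardinality of the stabilizer (`Finset.addStab`) of the `t`-popular set — `u ≤ h`, `h ∣ t − u`,
`u + h ≤ t` and the floor up to `u(h − u)`.  A predicate (no claim); implied by the printed conclusion of GW26 Conjecture 2.2
(`kneserPollardDichotomySharp_of_conclusion`). [original] -/
def KneserPollardDichotomySharp (A B : Finset G) (t : ℕ) : Prop :=
  t * A.card + t * B.card ≤ (∑ x ∈ A + B, min t (Pollard.rep A B x)) + t * t ∨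
  ∃ u : ℕ, ∃ A' ⊆ A, ∃ B' ⊆ B, 1 ≤ u ∧ u ≤ t ∧ (A \ A').card + (B \ B').card < u ∧
    (∀ x ∈ A' + B', u ≤ Pollard.rep A B x) ∧
    (u = t ∨
      (u ≤ (((A + B).filter fun x => t ≤ Pollard.rep A B x).addStab).card ∧
       (((A + B).filter fun x => t ≤ Pollard.rep A B x).addStab).card ∣ t - u ∧
       u + (((A + B).filter fun x => t ≤ Pollard.rep A B x).addStab).card ≤ t ∧
       t * A.card + t * B.card ≤ (∑ x ∈ A + B, min t (Pollard.rep A B x)) + t * t +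
         u * ((((A + B).filter fun x => t ≤ Pollard.rep A B x).addStab).card - u)))

/-- **Printed form ⇒ sharp consumer form.**  With `t = s|H| + u`, `1 ≤ u ≤ |H|`, `H = 𝖧(A′ + B′) = 𝖧(A +_t B)`: either `s = 0` (`u = t`), or
`s ≥ 1`, and then `|H| ∣ t − u = s|H|`, `u + |H| ≤ t`, and the printed bound is the floor up to `u(|H| − u)`. [original] -/
theorem kneserPollardDichotomySharp_of_conclusion (A B : Finset G) (t : ℕ)
    (h : t * A.card + t * B.card ≤ (∑ x ∈ A + B, min t (Pollard.rep A B x)) + t * t ∨ KneserPollardConclusion A B t) :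
    KneserPollardDichotomySharp A B t := by
  rcases h with hfloor | hconc
  · exact Or.inl hfloor
  obtain ⟨A', hA', B', hB', s, u, hu1, huH, htsu, hl, -, hpopset, hH, hbound⟩ := hconc
  right
  refine ⟨u, A', hA', B', hB', hu1, ?_, hl, ?_, ?_⟩
  · rw [htsu]; exact Nat.le_add_left u _
  · intro x hx
    rw [hpopset, mem_filter] at hx
    exact hx.2
  · rcases Nat.eq_zero_or_pos s with hs | hs
    · left; rw [htsu, hs, zero_mul, zero_add]
    · right
      set S : ℕ := ∑ x ∈ A + B, min t (Pollard.rep A B x) with hS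
      -- the stabilizer in the statement is `𝖧(A +_t B)`, equal to `𝖧(A′ + B′)` by the printed clause
      rw [← hH]
      set hh : ℕ := (A' + B').addStab.card with hhdef
      have hle : hh ≤ s * hh := Nat.le_mul_of_pos_left hh hs
      refine ⟨huH, ⟨s, by rw [htsu, Nat.add_sub_cancel, mul_comm]⟩, by omega, ?_⟩
      have hsub : ((hh - u : ℕ) : ℤ) = (hh : ℤ) - u := by push_cast [Nat.cast_sub huH]; ring
      have key : (t : ℤ) * A.card + t * B.card ≤ (S : ℤ) + t * t + u * ((hh : ℤ) - u) := by linarith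
      have : ((t * A.card + t * B.card : ℕ) : ℤ) ≤ ((S + t * t + u * (hh - u) : ℕ) : ℤ) := by
        push_cast [hsub]; linarith
      exact_mod_cast this

/-- The sharp dichotomy implies the plain one (`KneserPollardDichotomy`): `u + h ≤ t` gives `2u ≤ t` and `u(h − u) ≤ u(t − 2u)`. [original] -/
theorem dichotomy_of_sharp (A B : Finset G) (t : ℕ) (h : KneserPollardDichotomySharp A B t) :
    KneserPollardDichotomy A B t := by
  rcases h with hfloor | ⟨u, A', hA', B', hB', hu1, hut, hl, hpop, halt⟩
  · exact Or.inl hfloor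
  right
  refine ⟨u, A', hA', B', hB', hu1, hut, hl, hpop, ?_⟩
  rcases halt with rfl | ⟨huh, -, hsum, hbound⟩
  · exact Or.inl rfl
  · right
    refine ⟨by omega, hbound.trans (Nat.add_le_add_left (Nat.mul_le_mul_left u (by omega)) _)⟩

end KneserPollard

/-! ### The refined ceiling: the hull of `Z′_{<t}` under the stabilizer of the popular set -/

namespace STPPRepCount

variable {H : Type*} [AddCommGroup H] [DecidableEq H] {N : ℕ} {A B C : Fin N → Finset H}

/-- **(B3♯)** `N_t(X,Y) + |T| ≤ UB_B(t)` for every finset `T` disjoint from `Z′ = ⋃ (C i − A i)` on which `r_{X,Y} < t`: the ceiling charges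
every element outside `Z′` the full `t`, so each element of `T` is over-charged by at least one. [original] -/
theorem Nt_add_card_le_ubB [Fintype H] (h : IsSTPP A B C) (hB : ∀ i, (B i).Nonempty) (t : ℕ) (T : Finset H)
    (hT : Disjoint T (diffUnion A C)) (hTr : ∀ w ∈ T, repCount (diffUnion A B) (diffUnion B C) w < t) :
    Nt (diffUnion A B) (diffUnion B C) t + T.card ≤
      ubB (Fintype.card H) (fun i => (A i).card) (fun i => (B i).card) (fun i => (C i).card) t := by
  unfold Nt ubB pCA
  beta_reduce
  set X := diffUnion A B
  set Y := diffUnion B C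
  rw [← sum_add_sum_compl (diffUnion A C) fun w => min t (repCount X Y w)]
  have h1 : ∑ w ∈ diffUnion A C, min t (repCount X Y w) =
      ∑ i, (A i).card * (C i).card * min t (B i).card := by
    rw [diffUnion, sum_biUnion (pairwiseDisjoint_sub_CA h hB)]
    refine sum_congr rfl fun i _ => ?_
    have hinj : Set.InjOn (fun x : H × H => x.1 - x.2) ↑(C i ×ˢ A i) := by
      rintro ⟨c, a⟩ hp ⟨c', a'⟩ hq (he : c - a = c' - a')
      simp only [coe_product, Set.mem_prod, mem_coe] at hp hq
      obtain ⟨-, h2, h3⟩ := sub_CA_inj h (hB i) hp.2 hp.1 hq.2 hq.1 he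
      rw [h2, h3]
    rw [← image_sub_product, sum_image hinj]
    rw [sum_congr rfl fun (x : H × H) (hx : x ∈ C i ×ˢ A i) =>
      show min t (repCount X Y (x.1 - x.2)) = min t (B i).card by
        rw [mem_product] at hx; rw [repCount_eq h hx.2 hx.1]]
    rw [sum_const, card_product, smul_eq_mul]
    ring
  have hTsub : T ⊆ (diffUnion A C)ᶜ := by
    intro w hw
    rw [mem_compl]
    exact fun hw' => disjoint_left.mp hT hw hw'
  have h2 : (∑ w ∈ (diffUnion A C)ᶜ, min t (repCount X Y w)) + T.card ≤
      t * (Fintype.card H - ∑ i, (C i).card * (A i).card) := by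
    have hTc : T.card = ∑ w ∈ (diffUnion A C)ᶜ, if w ∈ T then 1 else 0 := by
      rw [sum_boole, filter_mem_eq_inter, inter_eq_right.mpr hTsub]; simp
    rw [hTc, ← sum_add_distrib]
    calc ∑ w ∈ (diffUnion A C)ᶜ, (min t (repCount X Y w) + if w ∈ T then 1 else 0)
        ≤ ∑ w ∈ (diffUnion A C)ᶜ, t := by
          refine sum_le_sum fun w _ => ?_
          by_cases hw : w ∈ T
          · rw [if_pos hw]
            have := hTr w hw
            have : min t (repCount X Y w) ≤ repCount X Y w := min_le_right _ _
            omega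
          · rw [if_neg hw, add_zero]; exact min_le_left _ _
      _ = t * (Fintype.card H - ∑ i, (C i).card * (A i).card) := by
          rw [sum_const, smul_eq_mul, card_compl, card_diffUnion_AC h hB, mul_comm]
  rw [h1]
  omega

/-- The sub-union `Z′_{<t} = ⋃_{b_i < t} (C i − A i)` has `Σ_{b_i < t} c_i a_i` elements. [original] -/
theorem card_diffUnion_AC_lt (h : IsSTPP A B C) (hB : ∀ i, (B i).Nonempty) (t : ℕ) :
    ((univ.filter fun i => (B i).card < t).biUnion fun i => C i - A i).card =
      ∑ i, if (B i).card < t then (C i).card * (A i).card else 0 := by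
  rw [card_biUnion (fun i hi j hj hij => pairwiseDisjoint_sub_CA h hB (mem_univ i) (mem_univ j) hij)]
  rw [sum_filter]
  exact sum_congr rfl fun i _ => by split_ifs <;> simp [card_sub_CA h i (hB i)]

/-- **The hull of `Z′_{<t}` under the stabilizer of the popular set is over-charged.**  Let `S = X +_t Y` (the `t`-popular sums) and
`K = S.addStab`.  Then `T := (Z′_{<t} + K) ∖ Z′_{<t}` is disjoint from `Z′` and carries `r_{X,Y} < t`: if `w = z + η` (`z ∈ Z′_{<t}`, `η ∈ K`) had
`r(w) ≥ t` (in particular if `w ∈ C_j − A_j` with `b_j ≥ t`), then `w ∈ S = η + S`, so `z ∈ S`, contradicting `r(z) = b_i < t`. [original] -/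
theorem hull_overcharged (h : IsSTPP A B C) {t : ℕ}
    (hS : ((diffUnion A B + diffUnion B C).filter fun x => t ≤ Pollard.rep (diffUnion A B) (diffUnion B C) x).Nonempty) :
    let Zlt := (univ.filter fun i => (B i).card < t).biUnion fun i => C i - A i
    let K := ((diffUnion A B + diffUnion B C).filter fun x => t ≤ Pollard.rep (diffUnion A B) (diffUnion B C) x).addStab
    Disjoint ((Zlt + K) \ Zlt) (diffUnion A C) ∧
      ∀ w ∈ (Zlt + K) \ Zlt, repCount (diffUnion A B) (diffUnion B C) w < t := by
  intro Zlt K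
  set X := diffUnion A B
  set Y := diffUnion B C
  set S := (X + Y).filter fun x => t ≤ Pollard.rep X Y x with hSdef
  -- key: every element of `Zlt + K` has fewer than `t` representations
  have key : ∀ w ∈ Zlt + K, repCount X Y w < t := by
    intro w hw
    obtain ⟨z, hz, η, hη, rfl⟩ := mem_add.mp hw
    by_contra hge
    rw [not_lt] at hge
    -- `z + η ∈ S`
    have hrep : t ≤ Pollard.rep X Y (z + η) := hge
    have hmemXY : z + η ∈ X + Y := by
      -- `rep ≥ t ≥ 1`? if `t = 0` the claim `repCount < 0` is impossible anyway; handle `t = 0` first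
      rcases Nat.eq_zero_or_pos t with ht0 | ht0
      · exfalso
        -- with `t = 0`, `Zlt` is empty (`card < 0` never holds)
        simp [Zlt, ht0] at hz
      · have : 0 < Pollard.rep X Y (z + η) := lt_of_lt_of_le ht0 hrep
        unfold Pollard.rep at this
        obtain ⟨p, hp⟩ := card_pos.mp this
        rw [mem_filter, mem_product] at hp
        exact mem_add.mpr ⟨p.1, hp.1.1, p.2, hp.1.2, hp.2⟩
    have hwS : z + η ∈ S := by rw [hSdef, mem_filter]; exact ⟨hmemXY, hrep⟩
    -- `S` is `K`-stable: `η +ᵥ S = S`, so `z ∈ S`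
    have hηS : η +ᵥ S = S := (Finset.mem_addStab hS).mp hη
    have hzS : z ∈ S := by
      rw [← hηS, mem_vadd_finset] at hwS
      obtain ⟨s', hs', he⟩ := hwS
      have : s' = z := by
        have := he; rw [vadd_eq_add, add_comm] at this; exact add_right_cancel this
      rw [← this]; exact hs'
    -- but `z ∈ C_i − A_i` with `b_i < t` has exactly `b_i` representations
    rw [hSdef, mem_filter] at hzS
    obtain ⟨i, hi, hzi⟩ := mem_biUnion.mp hz
    rw [mem_filter] at hi
    obtain ⟨c, hc, a, ha, rfl⟩ := mem_sub.mp hzi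
    have : Pollard.rep X Y (c - a) = (B i).card := repCount_eq h ha hc
    have := hzS.2; omega
  refine ⟨?_, fun w hw => key w (mem_sdiff.mp hw).1⟩
  rw [disjoint_left]
  intro w hw hwZ
  rw [mem_sdiff] at hw
  obtain ⟨hw1, hw2⟩ := hw
  -- `w ∈ Z′ ∖ Zlt` lies in some `C_j − A_j` with `b_j ≥ t`, so `r(w) = b_j ≥ t`: contradiction with `key`
  obtain ⟨j, -, hwj⟩ := mem_biUnion.mp hwZ
  obtain ⟨c, hc, a, ha, rfl⟩ := mem_sub.mp hwj
  have hr : repCount X Y (c - a) = (B j).card := repCount_eq h ha hc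
  have hlt := key _ hw1
  have hbj : (B j).card < t := by omega
  exact hw2 (mem_biUnion.mpr ⟨j, mem_filter.mpr ⟨mem_univ j, hbj⟩, hwj⟩)

end STPPRepCount

/-! ### Rule U11-KP♯ (shape level) -/

variable {N : ℕ}

/-- `hullSlack P h = (h − P mod h) mod h`: for `h ≥ 1` this is `h⌈P/h⌉ − P`, the least number of elements by which a union of `h`-cosets
containing a `P`-set exceeds it; `0` for `h = 0`.  [original] -/
def hullSlack (P h : ℕ) : ℕ := (h - P % h) % h

/-- `|Z′_{<t}| = Σ_{b_i < t} c_i a_i` on shape data (`STPPRepCount.card_diffUnion_AC_lt`). [original] -/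
def pCAlt (a b c : Fin N → ℕ) (t : ℕ) : ℕ := ∑ i, if b i < t then c i * a i else 0

/-- The conjectured loss of rule U11-KP♯ in form B at order `M` and parameter `t`:
`max {u(h − u) − hullSlack(|Z′_{<t}|, h) : 1 ≤ u ≤ h, h ∣ M, h ∣ t − u, u + h ≤ t, L_B(u) < u}` (truncated subtraction; `0` if there is no
such pair) — `h` ranges over `Nat.divisors M` (the possible orders of the stabilizer subgroup).  Computable (kills by `decide`). [original] -/
def lossKPSharp (M : ℕ) (a b c : Fin N → ℕ) (t : ℕ) : ℕ :=
  ((range (t + 1) ×ˢ Nat.divisors M).filter fun p =>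
      1 ≤ p.1 ∧ p.1 ≤ p.2 ∧ p.2 ∣ t - p.1 ∧ p.1 + p.2 ≤ t ∧ lB a b c p.1 < p.1).sup
    fun p => p.1 * (p.2 - p.1) - hullSlack (pCAlt a b c t) p.2

/-- **Rule U11-KP♯, form B**: for every `t` with `1 ≤ t ≤ min(P_AB, P_BC)` and `t ≤ L_B(t)`, `t (P_AB + P_BC) ≤ UB_B(t) + t² + lossKPSharp M t`.
Sound for STPP shape data CONDITIONALLY on the sharp Kneser–Pollard dichotomy (`u11KPSharpFormB_of_kneserPollardSharp`).  No claim by itself. [original] -/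
def U11KPSharpFormB (M : ℕ) (a b c : Fin N → ℕ) : Prop :=
  ∀ t : ℕ, 1 ≤ t → t ≤ pAB a b c → t ≤ pBC a b c → t ≤ lB a b c t →
    t * (pAB a b c + pBC a b c) ≤ ubB M a b c t + t * t + lossKPSharp M a b c t

/-- **Rule U11-KP♯, all three letter forms** (B; A = letters `(c, a, b)`; C = letters `(b, c, a)`).  No claim by itself. [original] -/
def U11KPSharp (M : ℕ) (a b c : Fin N → ℕ) : Prop :=
  U11KPSharpFormB M a b c ∧ U11KPSharpFormB M c a b ∧ U11KPSharpFormB M b c a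

/-- `hullSlack` is what it says: if `h ≥ 1`, `h ∣ m` and `P ≤ m` then `hullSlack P h ≤ m − P`. [bookkeeping] -/
theorem hullSlack_le_sub {P h m : ℕ} (hh : 0 < h) (hd : h ∣ m) (hPm : P ≤ m) : hullSlack P h ≤ m - P := by
  unfold hullSlack
  obtain ⟨q, rfl⟩ := hd
  have hP := Nat.div_add_mod P h
  have hmod : P % h < h := Nat.mod_lt P hh
  by_cases h0 : P % h = 0
  · rw [h0, Nat.sub_zero, Nat.mod_self]; exact Nat.zero_le _
  · have hlt : (h - P % h) % h = h - P % h := Nat.mod_eq_of_lt (by omega)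
    rw [hlt]
    -- `P/h < q` since `h q ≥ P > h (P/h)` would fail otherwise
    have hq : P / h + 1 ≤ q := by
      by_contra hq
      rw [not_le] at hq
      have : q ≤ P / h := by omega
      have := Nat.mul_le_mul_left h this
      omega
    have := Nat.mul_le_mul_left h hq
    rw [Nat.mul_add, Nat.mul_one] at this
    omega

/-- **Conditional soundness of rule U11-KP♯, form B.**  HYPOTHESIS `hKP`: the sharp Kneser–Pollard dichotomy holds for all finite `A, B` in every
abelian group and every `1 ≤ t ≤ min(|A|, |B|)`.  CONCLUSION: STPP shape data satisfy `U11KPSharpFormB |H|`.  In the structured branch with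
`u ≠ t`: `h = |K|`, `K` the stabilizer of `X +_t Y`, divides `|H|` (`Finset.Nonempty.card_addStab_dvd_card_univ`) and `t − u`; the hull
`Z′_{<t} + K` is over-charged by at least `hullSlack(|Z′_{<t}|, h)` (`STPPRepCount.hull_overcharged`, `STPPRepCount.Nt_add_card_le_ubB`,
`Finset.card_addStab_dvd_card_add_addStab`), and the fibre lemma gives `L_B(u) < u`; so `(u, h)` is one of the pairs of `lossKPSharp`. [original] -/
theorem u11KPSharpFormB_of_kneserPollardSharp
    (hKP : ∀ (G : Type) [AddCommGroup G] [DecidableEq G] (A B : Finset G) (t : ℕ),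
      1 ≤ t → t ≤ A.card → t ≤ B.card → KneserPollard.KneserPollardDichotomySharp A B t)
    {H : Type} [AddCommGroup H] [Fintype H] [DecidableEq H]
    {A B C : Fin N → Finset H} (h : IsSTPP A B C)
    (hA : ∀ i, (A i).Nonempty) (hB : ∀ i, (B i).Nonempty) (hC : ∀ i, (C i).Nonempty) :
    U11KPSharpFormB (Fintype.card H) (fun i => (A i).card) (fun i => (B i).card) (fun i => (C i).card) := by
  intro t ht1 htX htY htL
  have hXc : (diffUnion A B).card = pAB (fun i => (A i).card) (fun i => (B i).card) (fun i => (C i).card) :=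
    STPPRepCount.card_diffUnion_AB h hC
  have hYc : (diffUnion B C).card = pBC (fun i => (A i).card) (fun i => (B i).card) (fun i => (C i).card) :=
    STPPRepCount.card_diffUnion_BC h hA
  set X := diffUnion A B with hXdef
  set Y := diffUnion B C with hYdef
  have hsub : (∑ x ∈ X + Y, min t (Pollard.rep X Y x)) ≤ Nt X Y t := by
    unfold Nt
    exact sum_le_sum_of_subset (subset_univ _)
  have hceil := STPPRepCount.Nt_le_ubB h hB t
  rcases hKP H X Y t ht1 (hXc ▸ htX) (hYc ▸ htY) with hfloor | ⟨u, X', -, Y', -, hu1, hut, hl, hpop, halt⟩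
  · rw [hXc, hYc] at hfloor
    rw [mul_add]
    calc t * pAB _ _ _ + t * pBC _ _ _
        ≤ (∑ x ∈ X + Y, min t (Pollard.rep X Y x)) + t * t := hfloor
      _ ≤ ubB (Fintype.card H) _ _ _ t + t * t := Nat.add_le_add_right (hsub.trans hceil) _
      _ ≤ _ := Nat.le_add_right _ _
  · have hpop' : ∀ x ∈ X', ∀ y ∈ Y', u ≤ repCount X Y (x + y) :=
      fun x hx y hy => hpop (x + y) (add_mem_add hx hy)
    have hf := STPPRepCount.lB_le_card_sdiff_add h hA hC hpop'
    rw [← hXdef, ← hYdef] at hf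
    rcases halt with rfl | ⟨huh, hdvd, hsum, hbound⟩
    · exfalso; omega
    · rw [hXc, hYc] at hbound
      set S := (X + Y).filter fun x => t ≤ Pollard.rep X Y x with hSdef
      set K := S.addStab with hKdef
      set hh := K.card with hhdef
      have hKne : K.Nonempty := card_pos.mp (by omega)
      have hSne : S.Nonempty := Finset.Nonempty.of_addStab hKne
      -- `h ∣ |H|`
      have hdvdM : hh ∣ Fintype.card H := hSne.card_addStab_dvd_card_univ
      -- the over-charged hull
      set Zlt := (univ.filter fun i => (B i).card < t).biUnion fun i => C i - A i with hZlt
      obtain ⟨hTdisj, hTrep⟩ := STPPRepCount.hull_overcharged (A := A) (B := B) (C := C) h (t := t) hSne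
      have hceil' := STPPRepCount.Nt_add_card_le_ubB h hB t ((Zlt + K) \ Zlt) hTdisj hTrep
      -- `|T| ≥ hullSlack`
      have hZsub : Zlt ⊆ Zlt + K := subset_add_left Zlt ((Finset.zero_mem_addStab).mpr hSne)
      have hcardT : ((Zlt + K) \ Zlt).card = (Zlt + K).card - Zlt.card := card_sdiff_of_subset hZsub
      have hZcard : Zlt.card = pCAlt (fun i => (A i).card) (fun i => (B i).card) (fun i => (C i).card) t :=
        STPPRepCount.card_diffUnion_AC_lt h hB t
      have hdvdHull : hh ∣ (Zlt + K).card := card_addStab_dvd_card_add_addStab Zlt S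
      have hslack : hullSlack (pCAlt (fun i => (A i).card) (fun i => (B i).card) (fun i => (C i).card) t) hh ≤
          ((Zlt + K) \ Zlt).card := by
        rw [hcardT, ← hZcard]
        exact hullSlack_le_sub (by omega) hdvdHull (card_le_card hZsub)
      -- `(u, h)` is an admissible pair of `lossKPSharp`
      have hmem : (u, hh) ∈ ((range (t + 1) ×ˢ Nat.divisors (Fintype.card H)).filter fun p =>
          1 ≤ p.1 ∧ p.1 ≤ p.2 ∧ p.2 ∣ t - p.1 ∧ p.1 + p.2 ≤ t ∧
            lB (fun i => (A i).card) (fun i => (B i).card) (fun i => (C i).card) p.1 < p.1) := by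
        simp only [mem_filter, mem_product, mem_range, Nat.mem_divisors]
        exact ⟨⟨by omega, hdvdM, Fintype.card_ne_zero⟩, hu1, huh, hdvd, hsum, by omega⟩
      have hloss : u * (hh - u) - hullSlack (pCAlt (fun i => (A i).card) (fun i => (B i).card) (fun i => (C i).card) t) hh ≤
          lossKPSharp (Fintype.card H) (fun i => (A i).card) (fun i => (B i).card) (fun i => (C i).card) t :=
        le_sup (f := fun p : ℕ × ℕ => p.1 * (p.2 - p.1) -
          hullSlack (pCAlt (fun i => (A i).card) (fun i => (B i).card) (fun i => (C i).card) t) p.2) hmem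
      rw [mul_add]
      -- assemble: floor ≤ Σ + t² + u(h−u), Σ + |T| ≤ UB, hullSlack ≤ |T|, u(h−u) − hullSlack ≤ loss
      rw [← hXdef, ← hYdef] at hceil'
      have e1 : (∑ x ∈ X + Y, min t (Pollard.rep X Y x)) + ((Zlt + K) \ Zlt).card ≤
          ubB (Fintype.card H) (fun i => (A i).card) (fun i => (B i).card) (fun i => (C i).card) t :=
        (Nat.add_le_add_right hsub _).trans hceil'
      have e2 := Nat.sub_le_iff_le_add.mp hloss
      omega

/-- **Conditional soundness of rule U11-KP♯, three letter forms** (rotations as for `U11KP`). [original] -/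
theorem u11KPSharp_of_kneserPollardSharp
    (hKP : ∀ (G : Type) [AddCommGroup G] [DecidableEq G] (A B : Finset G) (t : ℕ),
      1 ≤ t → t ≤ A.card → t ≤ B.card → KneserPollard.KneserPollardDichotomySharp A B t)
    {H : Type} [AddCommGroup H] [Fintype H] [DecidableEq H]
    {A B C : Fin N → Finset H} (h : IsSTPP A B C)
    (hne : ∀ i, (A i).Nonempty ∧ (B i).Nonempty ∧ (C i).Nonempty) :
    U11KPSharp (Fintype.card H) (fun i => (A i).card) (fun i => (B i).card) (fun i => (C i).card) :=
  ⟨u11KPSharpFormB_of_kneserPollardSharp hKP h (fun i => (hne i).1) (fun i => (hne i).2.1) (fun i => (hne i).2.2),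
    u11KPSharpFormB_of_kneserPollardSharp hKP h.rotate.rotate (fun i => (hne i).2.2) (fun i => (hne i).1)
      (fun i => (hne i).2.1),
    u11KPSharpFormB_of_kneserPollardSharp hKP h.rotate (fun i => (hne i).2.1) (fun i => (hne i).2.2) (fun i => (hne i).1)⟩

/-- **`U11KPSharpSound` under the sharp Kneser–Pollard hypothesis** (item format).  CONDITIONAL. [original] -/
theorem u11KPSharpSound_of_kneserPollardSharp
    (hKP : ∀ (G : Type) [AddCommGroup G] [DecidableEq G] (A B : Finset G) (t : ℕ),
      1 ≤ t → t ≤ A.card → t ≤ B.card → KneserPollard.KneserPollardDichotomySharp A B t) :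
    ∀ (H : Type) [AddCommGroup H] [Fintype H] (N : ℕ) (A B C : Fin N → Finset H), IsSTPP A B C →
      (∀ i, (A i).Nonempty ∧ (B i).Nonempty ∧ (C i).Nonempty) →
        U11KPSharp (Fintype.card H) (fun i => (A i).card) (fun i => (B i).card) (fun i => (C i).card) := by
  intro H _ _ N A B C h hne
  classical
  exact u11KPSharp_of_kneserPollardSharp hKP h hne

end Summit.MatrixMultiplication.MatrixMultiplication.Theorems
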